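import Summits.BirchSwinnertonDyer.Rank1Residual.Additive.RamifiedSevenGenusKatoPinnedFrame
import Literature.NumberTheory.LFunctions.DepletedHeckeLSeriesEntire
import Literature.NumberTheory.EllipticCurves.RohrlichNonvanishing
import HarnessLib

set_option autoImplicit false

/-!
# `𝒞₇` genus road (crux `EllipticUnitValueSevenOfGZK`, K7r), row (K2C-3) block (An): the ANALYTIC BINDERS (hL) and (r5′) of
# the registered K2ᶜ input form `stub_integralComparisonInputsSeven` (zp v14) at every pinned frame — (hL) from Hecke's
# continuation theorem (ONE named fact), (r5′) REDUCED to Rohrlich 1988 (tree fact) through the Deuring–Shimura twist dictionary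

Cell bsd-cm, seat bsd-cm-prr-ty1 g31 (literature-prover), SUMMON `wake/SUMMON-bsd-cm-prr-ty1-20260830T1838Z.md` (planner
bsd-cm-plan g36, D927; key K2C-3), block (An); STATUS CHECKS (HEC)/(ROH) of this seat.  HONEST LABEL: theorems + ONE hypothesis
predicate (`PinnedKatoGenusFrame.HeckeTwistDictionary`, a `def … : Prop` with body, NOT a named fact — a statement about the
frame's own pinned objects, dischargeable later from the pin `ψ_LSeries` and modularity); no instance, no notation, no `sorry`.
The binder (hL) is discharged modulo the Literature fact `hecke1920_depletedHeckeL_entire` (Neukirch VII (8.6)); the binder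
(r5′) is discharged modulo the tree's Literature fact `Rohrlich1988_nonvanishing_twists_anyLevel`, a modularity witness
`IsNewformOf W f` (tree fact `ModularForms.exists_isNewformOf`, conjunct 2 of `stub_printFactsKato`) and the typed dictionary.
The stub itself is NOT proved; stmt-BirchSwinnertonDyer-19945 is OPEN; `X12.CMRamifiedSeven` is NOT proved; no summit
statement is proved by this seat; BSD is claimed for no curve.

## The two binders (zp v14 `6f202717661c60d4`, l.556–561, VERBATIM)

* (hL) `∀ χ : Field.absoluteGaloisGroup Φ.Kcm →ₜ* ℂˣ, ∃ Lf : ℂ → ℂ, CM.IsDepletedHeckeL Φ.ψ χ (7 * (7 * F.d)) Lf` — the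
  `(7·7D)`-depleted twisted series `L_{(7·7D)}(ψ̄, χ, s)` of THE Grössencharacter `ψ` of `W` (type `(1,0)`) has an entire
  continuation for EVERY continuous `χ` (Hecke 1920; Neukirch VII (8.6): «holomorphic on all of `ℂ`, if `𝔪 ≠ 1` or
  `p ≠ 0`» — here `p ≠ 0`).  §2: `hL_of_inputs`, from the fact at `K = Φ.Kcm` (imaginary quadratic: `finrank_Kcm`, and
  totally complex because `√−7 ∈ K`, `isTotallyComplex_Kcm`) and `Φ.ψ_infinityType`.
* (r5′) `∃ n₁ : ℕ, ∀ n : ℕ, n₁ ≤ n → ∀ χ …, (χ trivial on layer n+1) → IsPrimitiveRoot (χ Φ.γK) (7^(n+1)) → ∀ Lf, CM.IsDepletedHeckeL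
  Φ.ψ χ (7 * (7 * F.d)) Lf → Lf 1 ≠ 0` — generic non-vanishing of `L_{(7·7D)}(ψ̄, χ, 1)` at the characters of the cyclotomic
  `ℤ₇`-tower of `K` of large exact level.  §3: `r5'_of_inputs`, from Rohrlich's any-level theorem (Math. Ann. 281 (1988), as
  stated by Kato 13.5 (2), p. 227: «Let `S` be a finite set of prime numbers. Then the set {χ ∈ ⋃_{prime(m)⊂S} Hom((ℤ/m)^×,ℂ^×) ;
  L_S(f,χ,k/2) = 0} is finite»; tree `Rohrlich1988_nonvanishing_twists_anyLevel`, the 1984 form `P ∤ N` does NOT cover `7 ∣ N =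
  49D²`) applied to the newform `f` of `W` with `S = {7}`, THROUGH the dictionary `HeckeTwistDictionary Φ`: every layer
  character `χ` with `χ(γK)` primitive of order `7^{n+1}` has a PRIMITIVE Dirichlet avatar `χ_ℚ` of level `7^{n+2}` with
  `L_{(7·7D)}(ψ̄, χ, s) = Σ χ_ℚ(k) a_k(W) k^{−s}` (`re s > 2`).  The exceptional set being finite, its levels are bounded by some
  `n₁`, and for `n ≥ n₁` the level `7^{n+2} > n ≥ n₁` is not exceptional; an `Lf` with `CM.IsDepletedHeckeL` agrees with the
  twisted series on `re s > 2`, so `Lf 1 = 0` is impossible.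

## Why the dictionary is print + typing (its docstring; numbers, not adjectives)

`Σ_{(𝔞,7D)=1} ψ̄(𝔞)χ(𝔞)𝔑𝔞^{−s} = Σ_{(k,7D)=1} χ_ℚ(k) a_k(W) k^{−s} = Σ_k χ_ℚ(k) a_k(W) k^{−s}`: (1) `a_k(W) = Σ_{𝔑𝔞 = k} ψ(𝔞)` is the
frame's PIN `ψ_LSeries : heckeLFunction ψ s = W.LSeries s` read coefficientwise (Deuring; Dirichlet-coefficient uniqueness, Mathlib
`LSeries_eq_iff_of_abscissaOfAbsConv_lt_top`; `a_k(W) ∈ ℤ` is real so `ψ` may be replaced by `ψ̄`); (2) `χ(𝔞) = χ_ℚ(𝔑𝔞)` for the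
character `χ_ℚ` of `Gal(ℚ_{n+1}/ℚ) ≅ Gal(Kℚ_{n+1}/K)` (`K ∩ ℚ_∞ = ℚ`) read modulo `7^{n+2}` — Artin reciprocity in `K(μ_{7^∞})/K`
through the norm (tree `CyclotomicFrobenius.lean`); `χ_ℚ` is primitive of level `7^{n+2}` exactly when `χ` has order `7^{n+1}`,
i.e. `χ(γK)` is a primitive `7^{n+1}`-th root of unity; (3) the depletion at `7·D` is invisible on the right: `χ_ℚ(k) = 0` for
`7 ∣ k` and `a_q(W) = 0` at the additive primes `q ∣ D` (`bad_iff_dvd`; CM ⇒ additive).  Size L (the GL₁ dictionary of (1)–(2) is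
not in the tree: STATUS CHECK (ROH)); hence a typed hypothesis here, no fact.

## References
K. Kato, Astérisque 295 (2004) Prop. 15.9 (p. 258), 13.5 (2) (p. 227), Thm. 12.5 (2) (p. 221) [Kato2004Asterisque]; J. Neukirch,
*Algebraic Number Theory* VII §8 (8.6) (p. 503) [NeukirchANT1999]; E. Hecke, Math. Z. 6 (1920) [HeckeMathZ1920]; D. E. Rohrlich,
Invent. Math. 75 (1984) 409–423, Theorem p. 409 [RohrlichInventiones1984] and Math. Ann. 281 (1988) 611–632 (through Kato 13.5 (2));
G. Shimura, *Introduction to the arithmetic theory of automorphic functions* (1971) Thm. 3.66 [Shimura1971]; J. H. Silverman,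
*Advanced Topics* (1994) II Thm. 10.5 (Deuring) [SilvermanATAEC1994].
-/

noncomputable section

open scoped NumberField
open Field NumberField
open Literature.NumberTheory.GaloisRepresentations
open Literature.NumberTheory.EllipticCurves
open Literature.NumberTheory.EllipticCurves.Rank1Residual
open Literature.NumberTheory.EllipticCurves.IwasawaAlgebra
open Literature.NumberTheory.EllipticCurves.Kato2004
open Literature.NumberTheory.EllipticCurves.ModularForms
open Literature.NumberTheory.ComplexMultiplication.EllipticUnits
open Literature.NumberTheory.LFunctions
open Summit.BirchSwinnertonDyer.Rank1Residual

namespace Summit.BirchSwinnertonDyer.Rank1Residual.Additive.GenusSeven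

section Frame

variable {W : WeierstrassCurve ℚ} [W.IsElliptic] [W.IsGloballyMinimal] [Fact (Nat.Prime 7)]
  [ContinuousSMul ℤ_[7] (W.tateModule 7)] {K : ZpExtension ℚ 7} {hK : K.IsCyclotomic}
  {γ : Field.absoluteGaloisGroup ℚ} {I : IwasawaH1Data W 7 K γ}
  {F : GenusFrame} {θu : ∀ n : ℕ, globalUnitsOf (F.layer n)} {d : GenusDatum F θu}

namespace PinnedKatoGenusFrame

variable (Φ : PinnedKatoGenusFrame W K hK I d)

/-! ## §1 The CM field of the frame is imaginary quadratic -/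

/-- **`K = Φ.Kcm` is totally complex**: a real place would embed `√−7` into `ℝ`. [folklore] -/
theorem isTotallyComplex_Kcm : IsTotallyComplex Φ.Kcm := by
  refine ⟨fun v => ?_⟩
  rw [← InfinitePlace.not_isReal_iff_isComplex]
  intro hv
  have h : (InfinitePlace.embedding_of_isReal hv Φ.sqrtNegSeven) ^ 2 = -7 := by
    rw [← map_pow, Φ.sqrtNegSeven_sq, map_neg, map_ofNat]
  nlinarith [sq_nonneg (InfinitePlace.embedding_of_isReal hv Φ.sqrtNegSeven)]

/-- `K = Φ.Kcm` is an imaginary quadratic field (tree predicate `IsImaginaryQuadratic`, unfolded: `[K:ℚ] = 2` and totally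
complex). [folklore] -/
theorem finrank_Kcm_eq_two_and_isTotallyComplex : Module.finrank ℚ Φ.Kcm = 2 ∧ IsTotallyComplex Φ.Kcm :=
  ⟨Φ.finrank_Kcm, Φ.isTotallyComplex_Kcm⟩

/-! ## §2 (hL): the depleted twisted Hecke `L`-series of `ψ` have entire continuations — from Hecke's theorem -/

/-- **★ (hL) — the binder (hL) of `stub_integralComparisonInputsSeven` at every pinned frame, from the named fact
`hecke1920_depletedHeckeL_entire`** (Hecke 1920 / Neukirch VII (8.6) for `K = Φ.Kcm` imaginary quadratic and THE
Grössencharacter `Φ.ψ` of type `(1,0)`, `Φ.ψ_infinityType`): for every continuous `χ : Γ_K → ℂˣ` the series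
`L_{(7·7D)}(ψ̄, χ, s)` is the restriction of an entire function.
[cite: NeukirchANT1999, Ch. VII §8 (8.6) Corollary (p. 503)] [cite: HeckeMathZ1920, §1] [cite: Kato2004Asterisque, Prop. 15.9 (p. 258)] -/
theorem hL_of_inputs (hHecke : hecke1920_depletedHeckeL_entire) :
    ∀ χ : Field.absoluteGaloisGroup Φ.Kcm →ₜ* ℂˣ, ∃ Lf : ℂ → ℂ, CM.IsDepletedHeckeL Φ.ψ χ (7 * (7 * F.d)) Lf := by
  intro χ
  haveI := Φ.isTotallyComplex_Kcm
  exact hHecke Φ.Kcm Φ.finrank_Kcm Φ.ψ Φ.ψ_infinityType χ (7 * (7 * F.d))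

/-- (hL) with uniqueness: the continuation of each `L_{(7·7D)}(ψ̄, χ, s)` is unique (identity theorem,
`IsDepletedHeckeL.unique`). [cite: NeukirchANT1999, Ch. VII §8 (8.6) Corollary (p. 503)] -/
theorem hL_existsUnique_of_inputs (hHecke : hecke1920_depletedHeckeL_entire)
    (χ : Field.absoluteGaloisGroup Φ.Kcm →ₜ* ℂˣ) : ∃! Lf : ℂ → ℂ, CM.IsDepletedHeckeL Φ.ψ χ (7 * (7 * F.d)) Lf := by
  obtain ⟨Lf, hLf⟩ := Φ.hL_of_inputs hHecke χ
  exact ⟨Lf, hLf, fun L' hL' => IsDepletedHeckeL.unique hL' hLf⟩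

/-! ## §3 (r5′): generic non-vanishing at the cyclotomic layer characters — Rohrlich 1988 through the twist dictionary -/

/-- **The Deuring–Shimura TWIST DICTIONARY of the pinned frame** (typed hypothesis; module docstring «Why the dictionary is
print + typing»): every character `χ` of `Γ_K` trivial on the `(n+1)`-st layer of the cyclotomic `ℤ₇`-tower of `K` whose value
at the generator `γK` is a PRIMITIVE `7^{n+1}`-th root of unity has a PRIMITIVE Dirichlet avatar `χ_ℚ` of level `7^{n+2}` such
that `L_{(7·7D)}(ψ̄, χ, s) = Σ_k χ_ℚ(k) a_k(W) k^{−s}` for `re s > 2` (`a_k(W)` = Mathlib's `WeierstrassCurve.LFunction`, the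
Dirichlet coefficients pinned to `ψ` by `Φ.ψ_LSeries`).  Content: Deuring `a_k(W) = Σ_{𝔑𝔞=k} ψ(𝔞)` (coefficientwise
`ψ_LSeries`), Artin reciprocity `χ(𝔞) = χ_ℚ(𝔑𝔞)` in `K(μ_{7^∞})/K`, and `χ_ℚ(7) = 0`, `a_q(W) = 0` at `q ∣ D` (depletion
invisible).  A predicate; nothing asserted.
[cite: SilvermanATAEC1994, II Thm. 10.5] [cite: Shimura1971, Thm. 3.66] [cite: Kato2004Asterisque, Prop. 15.9 (p. 258) and §15.7 (p. 256)] -/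
def HeckeTwistDictionary : Prop :=
  ∀ (n : ℕ) (χ : Field.absoluteGaloisGroup Φ.Kcm →ₜ* ℂˣ),
    (∀ σ ∈ (K.restrictOfFinrankEqTwo (by decide) Φ.Kcm Φ.finrank_Kcm).layerSubgroup (n + 1), χ σ = 1) →
    IsPrimitiveRoot (((χ Φ.γK : ℂˣ)) : ℂ) (7 ^ (n + 1)) →
    ∃ χQ : DirichletCharacter ℂ (7 ^ (n + 2)), χQ.IsPrimitive ∧
      ∀ s : ℂ, 2 < s.re →
        CM.depletedHeckeLSeries Φ.ψ χ (7 * (7 * F.d)) s = LSeries (fun k ↦ χQ k * (W.LFunction k : ℂ)) s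

/-- Unfolding `HeckeTwistDictionary`. [cite: SilvermanATAEC1994, II Thm. 10.5] -/
theorem heckeTwistDictionary_iff : Φ.HeckeTwistDictionary ↔
    ∀ (n : ℕ) (χ : Field.absoluteGaloisGroup Φ.Kcm →ₜ* ℂˣ),
      (∀ σ ∈ (K.restrictOfFinrankEqTwo (by decide) Φ.Kcm Φ.finrank_Kcm).layerSubgroup (n + 1), χ σ = 1) →
      IsPrimitiveRoot (((χ Φ.γK : ℂˣ)) : ℂ) (7 ^ (n + 1)) →
      ∃ χQ : DirichletCharacter ℂ (7 ^ (n + 2)), χQ.IsPrimitive ∧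
        ∀ s : ℂ, 2 < s.re →
          CM.depletedHeckeLSeries Φ.ψ χ (7 * (7 * F.d)) s = LSeries (fun k ↦ χQ k * (W.LFunction k : ℂ)) s :=
  Iff.rfl

omit [W.IsElliptic] [W.IsGloballyMinimal] [Fact (Nat.Prime 7)] [ContinuousSMul ℤ_[7] (W.tateModule 7)] in
/-- For the newform `f` of `W`, the twisted series of `f` by `χ_ℚ` IS `Σ χ_ℚ(k) a_k(W) k^{−s}` (the coefficients of `f` are
those of `W`, `IsNewformOf`). [cite: BreuilConradDiamondTaylor2001, Thm. A] -/
theorem twistedLSeries_eq_of_isNewformOf {N : ℕ} [NeZero N] {f : CuspForm (CongruenceSubgroup.Gamma0 N) 2}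
    (hf : IsNewformOf W f) {m : ℕ} (χQ : DirichletCharacter ℂ m) (s : ℂ) :
    twistedLSeries f χQ s = LSeries (fun k ↦ χQ k * (W.LFunction k : ℂ)) s := by
  unfold twistedLSeries
  congr 1
  funext k
  rw [hf.2 k]

omit [Fact (Nat.Prime 7)] in
/-- **Rohrlich's exceptional set at `S = {7}` has bounded level**: there is `n₁` such that NO primitive Dirichlet character of
level `7^{n+2}` with `n₁ ≤ n` has `L(f, χ, 1) = 0` (value of the entire continuation of `Σ χ(k)a_k(f)k^{−s}`).
[cite: Kato2004Asterisque, 13.5 (2) (p. 227)] -/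
theorem exists_level_bound_of_rohrlich (hRo : Rohrlich1988_nonvanishing_twists_anyLevel) {N : ℕ} [NeZero N]
    {f : CuspForm (CongruenceSubgroup.Gamma0 N) 2} (hf : IsNewform0 f) :
    ∃ n₁ : ℕ, ∀ n : ℕ, n₁ ≤ n → ∀ χQ : DirichletCharacter ℂ (7 ^ (n + 2)), χQ.IsPrimitive →
      ∀ L : ℂ → ℂ, Differentiable ℂ L → (∀ s : ℂ, 2 < s.re → L s = twistedLSeries f χQ s) → L 1 ≠ 0 := by
  have hfin := hRo hf {7}
  refine ⟨hfin.toFinset.sup (fun χ => χ.1), fun n hn χQ hprim L hL hLs hL1 => ?_⟩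
  have hmem : (⟨7 ^ (n + 2), χQ⟩ : Σ m : ℕ, DirichletCharacter ℂ m) ∈ hfin.toFinset := by
    rw [Set.Finite.mem_toFinset]
    refine ⟨pow_ne_zero _ (by norm_num), ?_, hprim, L, hL, hLs, hL1⟩
    rw [Nat.primeFactors_prime_pow (by omega) (by norm_num)]
  have hle : 7 ^ (n + 2) ≤ hfin.toFinset.sup (fun χ => χ.1) := Finset.le_sup (f := fun χ => χ.1) hmem
  have hlt : n < 7 ^ (n + 2) := by
    calc n < n + 2 := by omega
      _ < 7 ^ (n + 2) := Nat.lt_pow_self (by norm_num)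
  omega

/-- **★ (r5′) — the binder (r5′) of `stub_integralComparisonInputsSeven` at every pinned frame, REDUCED to Rohrlich 1988
(tree fact `Rohrlich1988_nonvanishing_twists_anyLevel`), the newform of `W` (`IsNewformOf W f`, modularity) and the typed
twist dictionary `Φ.HeckeTwistDictionary`**: for all large `n`, every character `χ` of the `(n+1)`-st cyclotomic layer of `K`
with `χ(γK)` a primitive `7^{n+1}`-th root of unity, and every entire continuation `Lf` of `L_{(7·7D)}(ψ̄, χ, s)`, `Lf 1 ≠ 0`.
Proof: `Lf` agrees with the twisted series of `f` by the primitive avatar `χ_ℚ` (level `7^{n+2}`) on `re s > 2`, and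
Rohrlich's finite exceptional set at `S = {7}` has level `< 7^{n+2}` for `n ≥ n₁` (`exists_level_bound_of_rohrlich`).
[cite: Kato2004Asterisque, 13.5 (2) (p. 227) and Thm. 12.5 (2) (p. 221)] [cite: RohrlichInventiones1984, Theorem (p. 409)] -/
theorem r5'_of_inputs (hRo : Rohrlich1988_nonvanishing_twists_anyLevel) {N : ℕ} [NeZero N]
    {f : CuspForm (CongruenceSubgroup.Gamma0 N) 2} (hf : IsNewformOf W f) (hdict : Φ.HeckeTwistDictionary) :
    ∃ n₁ : ℕ, ∀ n : ℕ, n₁ ≤ n → ∀ χ : Field.absoluteGaloisGroup Φ.Kcm →ₜ* ℂˣ,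
      (∀ σ ∈ (K.restrictOfFinrankEqTwo (by decide) Φ.Kcm Φ.finrank_Kcm).layerSubgroup (n + 1), χ σ = 1) →
      IsPrimitiveRoot (((χ Φ.γK : ℂˣ)) : ℂ) (7 ^ (n + 1)) →
      ∀ Lf : ℂ → ℂ, CM.IsDepletedHeckeL Φ.ψ χ (7 * (7 * F.d)) Lf → Lf 1 ≠ 0 := by
  obtain ⟨n₁, hn₁⟩ := exists_level_bound_of_rohrlich hRo hf.1
  refine ⟨n₁, fun n hn χ hχ hprim Lf hLf => ?_⟩
  obtain ⟨χQ, hχQ, hser⟩ := hdict n χ hχ hprim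
  refine hn₁ n hn χQ hχQ Lf hLf.1 fun s hs => ?_
  have hs' : (3 / 2 : ℝ) < s.re := by linarith
  rw [hLf.2 s hs', hser s hs, twistedLSeries_eq_of_isNewformOf hf]

/-- **(hL) ∧ (r5′) together, in the letter of the stub's two conjuncts** (zp v14 l.556–561), at every pinned frame, from
Hecke's theorem, Rohrlich 1988, the newform of `W` and the twist dictionary.  CONDITIONAL; nothing else asserted; 19945 OPEN.
[cite: NeukirchANT1999, Ch. VII §8 (8.6) Corollary (p. 503)] [cite: Kato2004Asterisque, 13.5 (2) (p. 227)] -/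
theorem hL_and_r5'_of_inputs (hHecke : hecke1920_depletedHeckeL_entire) (hRo : Rohrlich1988_nonvanishing_twists_anyLevel)
    {N : ℕ} [NeZero N] {f : CuspForm (CongruenceSubgroup.Gamma0 N) 2} (hf : IsNewformOf W f)
    (hdict : Φ.HeckeTwistDictionary) :
    (∀ χ : Field.absoluteGaloisGroup Φ.Kcm →ₜ* ℂˣ, ∃ Lf : ℂ → ℂ, CM.IsDepletedHeckeL Φ.ψ χ (7 * (7 * F.d)) Lf) ∧
    (∃ n₁ : ℕ, ∀ n : ℕ, n₁ ≤ n → ∀ χ : Field.absoluteGaloisGroup Φ.Kcm →ₜ* ℂˣ,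
      (∀ σ ∈ (K.restrictOfFinrankEqTwo (by decide) Φ.Kcm Φ.finrank_Kcm).layerSubgroup (n + 1), χ σ = 1) →
      IsPrimitiveRoot (((χ Φ.γK : ℂˣ)) : ℂ) (7 ^ (n + 1)) →
      ∀ Lf : ℂ → ℂ, CM.IsDepletedHeckeL Φ.ψ χ (7 * (7 * F.d)) Lf → Lf 1 ≠ 0) :=
  ⟨Φ.hL_of_inputs hHecke, Φ.r5'_of_inputs hRo hf hdict⟩

end PinnedKatoGenusFrame

end Frame

end Summit.BirchSwinnertonDyer.Rank1Residual.Additive.GenusSeven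

end
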